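import Mathlib.Topology.Algebra.ContinuousMonoidHom
import Mathlib.RingTheory.AdicCompletion.Basic
import Mathlib.LinearAlgebra.TensorProduct.Basic
import Mathlib.Analysis.Normed.Field.Basic
import Mathlib.Analysis.Complex.Basic
import HarnessLib

/-!
# Joshi, *Arithmetic Teichmüller Spaces II½* (arXiv:2305.10398v12) §6.1–6.2 and §7.1–7.3: points of the adelic Arithmetic
# Teichmüller space, deformations (Thm. 6.2.1), holomorphoids (Def. 6.2.3), the standard arithmeticoid (§7.1), Galois
# cohomology of an arithmeticoid (Def. 7.2.4) and its multiplicative description (Prop. 7.2.2, (7.3.1)) — TYPED, nothing asserted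

Record file of the abc-iut cell, branch E «type Joshi's construction, test vs S» (rung LADDER-ABC:A2.E; seat abc-iut-E-t38,
slot T-38; node ids J2h:Prop6.1.2, Thm6.2.1, Def6.2.3, Prop7.2.2, Rmk7.2.3, Def7.2.4, Rmk7.2.5 of plan/E/JOSHI-DAG.tsv + the
un-numbered §7.1 standard arithmeticoid and §7.3 Bloch–Kato subspaces; Prop. 7.4.1 / 7.5.1 / §7.6 are the sequel
`Joshi/ArithmeticoidCollation.lean`). SOURCE: K. Joshi, *Construction of Arithmetic Teichmüller Spaces II½: Deformations of
Number Fields*, arXiv:2305.10398**v12** (24 Feb 2025; «Preliminary version for comments», UNREFEREED; bib `Joshi2023ATS2half`;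
it is the «[Joshi, 2023a]» of arXiv:2401.13508 = [J-III]). Locators «p.N l.M» = line M of page file `pNNNN.txt` of the cell's
render `HOME/plan/repair/lit/renders/Joshi-arxiv-2305.10398-ATS2half/` (PDF page N). [J-I] = arXiv:2106.11452v4 (render
`HOME/plan/repair/lit/renders/Joshi-ATS1-2106.11452v4-PDFpaged-book-anonnd/`). **No side is taken** on [IUTchIII] Cor. 3.12,
on Joshi's claims, or on Mochizuki's report on them (bib `Mochizuki2024JoshiReport`); typed ≠ proved; typed AS A CANDIDATE ≠
endorsed. Every statement print ASSERTS is a `Prop`-valued `def` tagged `@[claim "Joshi2023ATS2half" "disputed"]` («disputed»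
records that a dispute exists in print and takes no side), never an axiom, instance, `sorry` or Literature fact; what FOLLOWS
from the typed signature is a proved `theorem`.

CARRIERS (INTERIM CARRIER RULE, plan/E/ASSIGNMENTS.md §0.3; instance-free — carrier types are PARAMETERS with their Mathlib
instances, non-instance data is bundled in small structures): places `V` of the number field `L` (no real embeddings,
p.45 l.34), archimedean places `IsArc : Set V`, residue characteristics `p : V → ℕ`, completions `Lv v` (`NormedField`), the
local parameter spaces `Pt v = |Y_{L̂♭_v,L_v}|` (closed classical points of the Fargues–Fontaine curve; [J-II½] Def. 4.1.1,
§4.8 — slot T-37), so that AN ARITHMETICOID IS A POINT `y : ∀ v, Pt v` of `𝒴_L = ∏_v |Y_{L̂♭_v,L_v}|` (Def. 5.1.1 p.29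
l.48–58: «An arithmeticoid of L … is a point y ∈ 𝒴_L … for each v ∈ V_L one is given an untilt (L_v ↪ K_v, K♭_v ≃ L̂♭_v)») —
a Pi-type, so NO competing definition is made here and the file composes with T-37's `Joshi/Arithmeticoids.lean` (file of
record for §4–§5; merge-debt: J2h:Def4.1.1/5.1.1/5.2.1/5.15.1 = T-37); the residue fields `K v y_v` (topological fields; the
untilt at `y_v`); the absolute Galois groups `G v y_v = G_{L_v;K_{y_v}}` (topological groups; §7.2 p.46 l.33–38); the
cohomology groups `H i v y_v` = the group (7.2.1) assigns to `(i, v, y_v)` — `H^i(G_{L_v;K_v}, ℤ_{p_v}(1))` at non-archimedean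
`v`, `Ext^i_{MHS}(ℤ(0), ℤ(1))` at archimedean `v` — written MULTIPLICATIVELY (`CommGroup`, Rmk. 7.2.3 p.47 l.23–24: «the main
groups of interest in this paper have a multiplicative description») with a topology, in any of its four variants (integral /
rational / Fontaine parts, Def. 7.2.4, §7.3). Mathlib objects used to STATE the classical identifications of Prop. 7.2.2 and
(7.3.1): `AdicCompletion (Ideal.span {p}) (Additive K^×) = lim_n K^×/K^{×p^n}` and `ℚ ⊗[ℤ] (·)` for «`⊗_{ℤ_p} ℚ_p`» (OUR
RENDERING: for a `ℤ_p`-module `M`, `M ⊗_{ℤ_p} ℚ_p = M ⊗_ℤ ℚ` since `ℚ_p = ℤ_p ⊗_ℤ ℚ` — flag for E-ref). NONE of our frozen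
objects is imported (E-PLAN R14); nearest FQNs are named in docstrings only. Merge-debts: E-t1 `Joshi/ArithTeichmullerSpace.lean`
([J-I] local ATS and Thm. 8.4.1), E-t5 holomorphoids ([J-III] Def. 2.1.2 restates Def. 6.2.3), E-t19 `BlochKatoDatum` / E-t21
`LocalBKDatum` (the [J-III] §9.1/§9.6 local carriers of `H¹`, `H¹_e`, `H¹_f`, the Kummer map). NOT TYPED (no carriers; no
bearing on S; quoted only): Thm. 6.2.1 (2)–(4) (analytic spaces, fundamental-group isomorphs), the Frobenioid clause of
Prop. 6.1.2 (Prop. 5.15.1/§5.16 = T-37), the `(∏_v ℤ_{p_v}) × ℤ`-module structure of Def. 7.2.4, Rmk. 7.2.5 (p.47 l.64–69: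
«many Galois cohomology theories — each indexed by an arithmeticoid» — realised by the dependent type `H i v (y v)`). READING
FLAG for E-ref in the docstring of `Thm621`. Standard axioms only; sorry-free. [claim: Joshi2023ATS2half, status: disputed]
-/

set_option autoImplicit false

noncomputable section

open Set
open scoped TensorProduct

namespace Summit.ABC.IUTFork.Joshi.ATS2half

universe u

/-! ## 1. §6.1–6.2: points of the adelic Arithmetic Teichmüller space, deformations, holomorphoids
(J2h:§6.1, Prop6.1.2, Thm6.2.1, Def6.2.3) -/

section AdelicATS

variable {V : Type u} (Pt : V → Type u)

/-- **§6.1 (6.1.1)** (p.43 l.26–37): «A point of the adelic Teichmuller space 𝔍(X/L) may be understood as a collection of local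
arithmetic holomorphic structures for each v ∈ V_L: (Y/L_v, L_v ↪ K_v, K♭_v ≃ L̂♭_v, ∗_{K_v} : 𝓜(K_v) → Y^an_{L_v})_{v∈V_L}
such that for each v ∈ V_L, Y/L_v is tempered anabelomorphic with X/L_v». SIGNATURE over the interim carriers: the untilt at
`v` is the point `arith v : Pt v` of `|Y_{L̂♭_v,L_v}|`, and `Loc v y_v` is the abstract sort of the remaining local data at `v`
over that untilt (the curve `Y/L_v` tempered-anabelomorphic to `X/L_v` and the morphism `∗_{K_v}`; [J-I] objects — merge-debt
E-t1 `Joshi/ArithTeichmullerSpace.lean`). Definition (data), nothing asserted. [claim: Joshi2023ATS2half, status: disputed] -/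
structure AdelicATSPoint (Loc : (v : V) → Pt v → Type u) where
  /-- the untilts `(L_v ↪ K_v, K♭_v ≃ L̂♭_v)_v`, i.e. the underlying point of `𝒴_L` -/
  arith : ∀ v, Pt v
  /-- the local arithmetic holomorphic structure at `v` over that untilt -/
  localStructure : ∀ v, Loc v (arith v)

/-- **Prop. 6.1.2, arithmeticoid clause — DERIVED as the forgetful map** (p.43 l.38–p.44 l.3): «Let (Y/L_v, L_v ↪ K_v,
K♭_v ≃ F_v, 𝓜(K_v) → X^an_{L_v})_{v∈V_L} ∈ 𝔍(X/L) be any point of the adelic arithmetic Teichmuller space. Then this provides a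
natural arithmeticoid arith(L) given by arith(L) = (L_v ↪ K_v, K♭_v ≃ F_v)_{v∈V_L}» («Proof. … immediate from the definition of
arithmeticoid», p.44 l.9–10). The Frobenioid clause («hence a natural isomorphism of perfect Frobenioids Frob(arith(L)) ≃
Frob(L)^pf (Proposition 5.15.1) and an isomorphism of realified Frobenioids Frob(arith(L))^ℝ ≃ Frob(L)^ℝ given in §5.16»,
p.44 l.4–8) is NOT typed here: Prop. 5.15.1 / §5.16 are slot T-37's rows (E never re-files). [claim: Joshi2023ATS2half,
status: disputed] -/
def AdelicATSPoint.toArithmeticoid {Loc : (v : V) → Pt v → Type u} (P : AdelicATSPoint Pt Loc) : ∀ v, Pt v :=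
  P.arith

/-- Every arithmeticoid all of whose local sorts are inhabited underlies some point of `𝔍(X/L)` (the converse direction of the
forgetful map; elementary). [claim: Joshi2023ATS2half, status: disputed] -/
theorem AdelicATSPoint.toArithmeticoid_surjective {Loc : (v : V) → Pt v → Type u} (h : ∀ v (y : Pt v), Nonempty (Loc v y)) :
    Function.Surjective (AdelicATSPoint.toArithmeticoid Pt (Loc := Loc)) := fun y =>
  ⟨⟨y, fun v => Classical.choice (h v (y v))⟩, rfl⟩

/-- **Def. 6.2.3 / (6.2.4)** (p.45 l.34–48): «Let L be a number field (assumed to have no real embeddings) and let X/L be a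
quasi-projective variety over L. Then a global holomorphoid of X/L, or more simply an arithmetic holomorphoid of X/L, or even
more simply a holomorphoid of X/L is the datum (X ↪ arith(L)_y) consisting of an arithmeticoid arith(L)_y with y = (y_v)_{v∈V_L}
and, for each v ∈ V_L, a morphism (6.2.4) 𝓜(K_{y_v}) → X^an_{L_v} of analytic spaces. I will write the holomorphoid … as
hol(X/L)_y … Evidently, if (X, arith(L)_y) is a holomorphoid then (X/L_v, L_v ↪ K_{y_v}, K♭_{y_v} ≃ F_{y_v}, 𝓜(K_{y_v}) →
X^an_{L_v})_{v∈V_L} is a point i.e. an object of … 𝔍(X/L)». SIGNATURE: `Morph v y_v` = the abstract sort of morphisms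
`𝓜(K_{y_v}) → X^an_{L_v}` (no analytic spaces in tree/Mathlib). Merge-debt: [J-III] Def. 2.1.2 restates this notion (slot
T-05); E-t10/E-t21 label holomorphoids of the fixed `X` by their arithmeticoid `y`, consistently with `Holomorphoid.arith`.
(Rmk. 6.2.2 / Rmk. 6.2.5, p.45 l.31–33 / l.49–54: the classical-Teichmüller analogy — prose, not typed.)
[claim: Joshi2023ATS2half, status: disputed] -/
structure Holomorphoid (Morph : (v : V) → Pt v → Type u) where
  /-- the arithmeticoid `arith(L)_y`, `y = (y_v)_v` -/
  arith : ∀ v, Pt v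
  /-- the morphisms (6.2.4) `𝓜(K_{y_v}) → X^an_{L_v}`, one per place -/
  morph : ∀ v, Morph v (arith v)

/-- Def. 6.2.3, last sentence (p.45 l.43–48): a holomorphoid «is a point i.e. an object of 𝔍(X/L)», given the evident
conversion of its local morphisms into local arithmetic holomorphic structures (`toLoc`, abstract). DERIVED (definitional).
[claim: Joshi2023ATS2half, status: disputed] -/
def Holomorphoid.toATSPoint {Morph Loc : (v : V) → Pt v → Type u} (toLoc : ∀ v (y : Pt v), Morph v y → Loc v y)
    (h : Holomorphoid Pt Morph) : AdelicATSPoint Pt Loc :=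
  ⟨h.arith, fun v => toLoc v _ (h.morph v)⟩

/-- The point of `𝔍(X/L)` underlying `hol(X/L)_y` has arithmeticoid `y`. [claim: Joshi2023ATS2half, status: disputed] -/
theorem Holomorphoid.toATSPoint_arith {Morph Loc : (v : V) → Pt v → Type u} (toLoc : ∀ v (y : Pt v), Morph v y → Loc v y)
    (h : Holomorphoid Pt Morph) : (h.toATSPoint Pt toLoc).toArithmeticoid = h.arith :=
  rfl

variable (K : (v : V) → Pt v → Type u) [∀ v y, Field (K v y)] [∀ v y, TopologicalSpace (K v y)]

/-- The arithmetic ring `∏_{v∈V_L} K_v` of `arith(L)_y` with the product topology ([J-II½] §5.1, p.30 l.1–4 — slot T-37's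
row; restated minimally as the Pi-type because Def. 5.2.1 below needs it). [claim: Joshi2023ATS2half, status: disputed] -/
abbrev arithRing (y : ∀ v, Pt v) : Type u := ∀ v, K v (y v)

/-- **Def. 5.2.1** (p.31 l.44–45, upstream of Thm. 6.2.1 (1)): «two arithmeticoids arith(L)_{y₁}, arith(L)_{y₂} are
topologically equivalent if and only if their arithmetic rings are topologically isomorphic» — a ring isomorphism that is a
homeomorphism. (Slot T-37's row; typed here only as the predicate Thm. 6.2.1 negates.) [claim: Joshi2023ATS2half,
status: disputed] -/
def TopEquivalent (y₁ y₂ : ∀ v, Pt v) : Prop :=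
  ∃ e : arithRing Pt K y₁ ≃+* arithRing Pt K y₂, Continuous e ∧ Continuous e.symm

/-- The local clause the PROOF of Thm. 6.2.1 negates (p.45 l.11–16): «the perfectoid residue fields K_{1,v} and K_{2,v} are …
topologically isomorphic» (isomorphic as topological fields). [claim: Joshi2023ATS2half, status: disputed] -/
def LocTopIso (v : V) (a b : Pt v) : Prop :=
  ∃ e : K v a ≃+* K v b, Continuous e ∧ Continuous e.symm

/-- **The cited input of the proof of Thm. 6.2.1** (p.45 l.11–18): «For each v ∈ S, let me choose y_{2,v} ∈ Y_{L̂♭_v,L_v} such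
that the perfectoid residue fields K_{1,v} and K_{2,v} are not topologically isomorphic (these choices are possible by the axiom
of choice). The existence of such fields is established by [Kedlaya and Temkin, 2018].» Typed as the availability, at every
non-archimedean place and for every point, of a second point with non-homeomorphic residue field. HYPOTHESIS (a published
input as Joshi uses it; not asserted). [claim: Joshi2023ATS2half, status: disputed] -/
@[claim "Joshi2023ATS2half" "disputed"]
def KedlayaTemkinChoice (IsArc : Set V) : Prop :=
  ∀ v, v ∉ IsArc → ∀ a : Pt v, ∃ b : Pt v, ¬ LocTopIso Pt K v a b

/-- **Thm. 6.2.1, clauses (1) and (2′)** (p.44 l.20–29): «Let L be a number field and let ∅ ≠ S ⊂ V^non_L be a non-empty set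
of non-archimedean primes of L (S is not be assumed to be finite). Let arith(L)_{y₁} be an arithmeticoid of L. Let X/L be a
geometrically connected smooth, projective variety over L. Then there exists an arithmeticoid arith(L)_{y₂} of L such that
(1) the arithmeticoids arith(L)_{y₁} and arith(L)_{y₂} are not topologically equivalent (and hence not equivalent), and (2) for
each v ∈ S, the Q_v-analytic spaces X^an_{K_{1,v}} and X^an_{K_{2,v}} are not isomorphic.» Typed: (1) verbatim (Def. 5.2.1) and,
in place of (2), the clause (2′) its proof establishes («K_{1,v} and K_{2,v} are not topologically isomorphic», p.45 l.15–16,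
whence (2) «by one of the main theorems of [Joshi, 2021a, Section 3]», p.45 l.26–28). NOT typed: (2) itself (no analytic
spaces), (3) «distinct members of the isomorphism class of X/L», (4) the isomorphs of `π₁^{et}(X/L)` and `π₁^{temp}(X^an_{L_v})`
(p.44 l.30–p.45 l.10). HYPOTHESIS (claim). [claim: Joshi2023ATS2half, status: disputed] -/
@[claim "Joshi2023ATS2half" "disputed"]
def Thm621 (IsArc : Set V) : Prop :=
  ∀ S : Set V, S.Nonempty → S ⊆ IsArcᶜ → ∀ y₁ : ∀ v, Pt v, ∃ y₂ : ∀ v, Pt v,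
    ¬ TopEquivalent Pt K y₁ y₂ ∧ ∀ v ∈ S, ¬ LocTopIso Pt K v (y₁ v) (y₂ v)

/-- **The construction step of the proof of Thm. 6.2.1 — DERIVED** from `KedlayaTemkinChoice` (p.45 l.11–22): choosing
`y_{2,v}` with non-homeomorphic residue field at `v ∈ S` and «for v ∉ S, choose y_{2,v} = y_{1,v}. This gives a y₂ ∈ 𝒴_L. By
construction, for all v ∈ S, one has y_{1,v} ≠ y_{2,v}». (That this `y₂` is not topologically equivalent to `y₁` — clause (1) —
is print's «by construction», p.45 l.23–24, and stays inside the claim `Thm621`.) [claim: Joshi2023ATS2half, status: disputed] -/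
theorem thm621_construction {IsArc : Set V} (hKT : KedlayaTemkinChoice Pt K IsArc) (S : Set V) (hS : S ⊆ IsArcᶜ)
    (y₁ : ∀ v, Pt v) :
    ∃ y₂ : ∀ v, Pt v, (∀ v ∈ S, ¬ LocTopIso Pt K v (y₁ v) (y₂ v) ∧ y₁ v ≠ y₂ v) ∧ ∀ v, v ∉ S → y₂ v = y₁ v := by
  classical
  let y₂ : ∀ v, Pt v := fun v => if hv : v ∈ S then Classical.choose (hKT v (hS hv) (y₁ v)) else y₁ v
  have hy₂S : ∀ v (hv : v ∈ S), y₂ v = Classical.choose (hKT v (hS hv) (y₁ v)) := fun v hv => dif_pos hv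
  have hy₂nS : ∀ v, v ∉ S → y₂ v = y₁ v := fun v hv => dif_neg hv
  refine ⟨y₂, fun v hv => ?_, hy₂nS⟩
  have hc := Classical.choose_spec (hKT v (hS hv) (y₁ v))
  rw [hy₂S v hv]
  refine ⟨hc, fun heq => hc ?_⟩
  rw [← heq]
  exact ⟨RingEquiv.refl _, continuous_id, continuous_id⟩

end AdelicATS

/-! ## 2. §7.1–7.3: the standard arithmeticoid, Galois cohomology of an arithmeticoid, Bloch–Kato subspaces
(J2h:§7.1, (7.2.1), Prop7.2.2, Rmk7.2.3, Def7.2.4, §7.3/(7.3.1)) -/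

section GaloisCohomology

variable {V : Type u} {Pt : V → Type u}

/-- **Def. 7.2.4** (p.47 l.25–48): «The galois cohomology of an arithmeticoid with integral coefficients (resp. with rational
coefficients) is the product H^i(arith(L)_y, ℤ(1)) := ∏_{v∈V^non_L} H^i(G_{L_v;K_v}, ℤ_{p_v}(1)) × ∏_{v∈V^arc_L} Ext^i(ℤ(0),ℤ(1)),
and respectively the product H^i(arith(L)_y, ℚ(1)) := ∏_{v∈V^non_L} H^i(G_{L_v;K_v}, ℚ_{p_v}(1)) × ∏_{v∈V^arc_L} Ext^i(ℚ(0),ℚ(1))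
… the integral (resp. rational) Galois cohomology provided by the arithmeticoid arith(L)_y.» DERIVED definition: with the case
split of (7.2.1) (p.46 l.41–49: «H^i(G_{L_v}, ℤ_{p_v}(1)) = Ext^i_{MHS}(ℤ(0),ℤ(1)) if v ∈ V^arc_L; H^i(G_{L_v,K_v}, ℤ_{p_v}(1)) if
v ∈ V^non_L») built into the carrier `H i v y_v`, the product over all places is the Pi-type; it is a commutative group with
the product topology by instance inference, for ANY of the four coefficient variants (instantiate `H`). Its being a module
over `(∏_{v non} ℤ_{p_v}) × ℤ` (p.47 l.49–63) is not typed beyond the `ℤ`-module structure every abelian group carries. OUR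
nearest object (not bound): `Summit.ABC.IUTFork.Thm311.LogShells.Packet1 vQ`, the product over `v ∣ v_ℚ` on the log-shell
side. [claim: Joshi2023ATS2half, status: disputed] -/
abbrev CohArith (H : ℕ → (v : V) → Pt v → Type u) (i : ℕ) (y : ∀ v, Pt v) : Type u := ∀ v, H i v (y v)

variable (H : ℕ → (v : V) → Pt v → Type u) [∀ i v y, CommGroup (H i v y)]

/-- **§7.3, Fontaine / Bloch–Kato subspaces of the adelic cohomology** (p.47 l.70–p.48 l.4): «H^i_f(arith(L)_y, ℤ(1)) :=
∏_{v∈V^non_L} H^i_f(G_{L_v;K_v}, ℤ_{p_v}(1)) × ∏_{v∈V^arc_L} Ext^i(ℤ(0),ℤ(1))» (and the rational one), «the integral Fontaine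
subspace of H^i(arith(L)_y, ℤ(1)) (resp. the rational Fontaine subspace …)». DERIVED: the product subgroup of the local
subgroups `Hf i v y_v ≤ H i v y_v` (at archimedean `v` take `Hf = ⊤`, as print takes the whole `Ext^i`). Merge-debt: the local
`H¹_e ⊆ H¹_f` of [J-III] §9.1 are E-t19's `BlochKatoDatum` / E-t21's `LocalBKDatum` fields. [claim: Joshi2023ATS2half,
status: disputed] -/
def cohArithF (Hf : ∀ i v (y : Pt v), Subgroup (H i v y)) (i : ℕ) (y : ∀ v, Pt v) : Subgroup (CohArith H i y) :=
  Subgroup.pi Set.univ fun v => Hf i v (y v)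

/-- Membership in the adelic Fontaine subspace is factorwise. [claim: Joshi2023ATS2half, status: disputed] -/
theorem mem_cohArithF_iff (Hf : ∀ i v (y : Pt v), Subgroup (H i v y)) (i : ℕ) (y : ∀ v, Pt v) (c : CohArith H i y) :
    c ∈ cohArithF H Hf i y ↔ ∀ v, c v ∈ Hf i v (y v) := by
  simp [cohArithF, Subgroup.mem_pi]

variable [∀ i v y, TopologicalSpace (H i v y)]

/-- **§7.1, the STANDARD arithmeticoid and the functoriality datum of [J-I] Thm. 8.4.1** — the non-instance data of §7 over
the carriers `G v y_v = G_{L_v;K_{y_v}}` (p.46 l.33–38: «let G_{L_v;K_v} = Gal(L̄_v/L_v) be the absolute Galois group of L_v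
given using the algebraic closure L̄_v ⊂ K_v of L_v in K_v») and `H`:
* `canonicalFibre v ⊆ Pt v` and `std` (p.46 l.10–32): «I will chose an arithmeticoid arith(L)_{y₀} which I will call the
  standard arithmeticoid of L. This is chosen as follows. For each prime v ∈ V^non_L choose a closed classical point y_v ∈
  Y_{L̂♭_v,L_v} which lies in the fiber of over the canonical point of X_{L̂♭_v,L_v}. For v ∈ V^arc_L, let y_v be any point …
  The point y₀ = (y_v)_{v∈V_L} ∈ 𝒴_L thus provides by definition an arithmeticoid arith(L)_{y₀} … Note that arith(L)_{y₀} is not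
  unique!» — the chosen `std` with its defining constraint `std_mem`; non-uniqueness is the predicate `IsStandard` below;
* `coh` = [J-I] Thm. 8.4.1 (1) (v4 p.45 l.42–57), the functoriality Joshi's proof of Prop. 7.4.1 invokes «for each factor»:
  «Any anabelomorphism Π^temp_{X/E;K} ≃ Π^temp_{X/E;ℂ_p} provides, for all integers i ≥ 0, … an isomorphism H^i(G_{E′;K}, Ẑ(1)_K)
  ≃ H^i(G_E, Ẑ(1)) and also an isomorphism (of ℚ_p-vector spaces) H^i(G_{E′;K}, ℚ_p(1)_K) ≃ H^i(G_E, ℚ_p(1))» («the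
  anabelomorphism G_{E′;K} ≃ G_E induces an isomorphism of Ẑ(1)_K ≃ Ẑ(1) which is compatible with [the actions]», [J-I] p.46
  l.1–3) — AS DATA: an isomorphism of topological groups `G v a ≃ₜ* G v b` induces one `H i v a ≃ₜ* H i v b`.
SIGNATURE; nothing asserted (the properties print claims for these data are the `Prop`s below). Merge-debt: [J-I] Thm. 8.4.1
itself = E-t1 / T-25. [claim: Joshi2023ATS2half, status: disputed] -/
structure CohomologyDatum (IsArc : Set V) (G : (v : V) → Pt v → Type u) [∀ v y, Group (G v y)]
    [∀ v y, TopologicalSpace (G v y)] where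
  /-- §7.1: the fibre of `|Y_{L̂♭_v,L_v}| → |X_{L̂♭_v,L_v}|` over the canonical point (non-archimedean `v`) -/
  canonicalFibre : ∀ v, Set (Pt v)
  /-- §7.1: the chosen standard point `y₀ ∈ 𝒴_L` -/
  std : ∀ v, Pt v
  /-- §7.1: at non-archimedean `v`, `y₀,v` lies over the canonical point -/
  std_mem : ∀ v, v ∉ IsArc → std v ∈ canonicalFibre v
  /-- [J-I] Thm. 8.4.1 (1): an anabelomorphism of local Galois groups induces isomorphisms on cohomology -/
  coh : ∀ (i : ℕ) (v : V) (a b : Pt v), (G v a ≃ₜ* G v b) → (H i v a ≃ₜ* H i v b)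

variable {H}
variable {IsArc : Set V} {G : (v : V) → Pt v → Type u} [∀ v y, Group (G v y)] [∀ v y, TopologicalSpace (G v y)]

/-- §7.1 (p.46 l.10–32): `y` IS A standard arithmeticoid — every non-archimedean coordinate lies over the canonical point
(«There are many possible arithmeticoids which may be used as standard arithmeticoids of L», p.46 l.31–32). OUR nearest object
(not bound): the standard point of [J-III] §4.4 is E-t8's `AnsatzStandardPoint` row (dictionary row D-06, standard point ↦
`qK`). [claim: Joshi2023ATS2half, status: disputed] -/
def CohomologyDatum.IsStandard (𝔠 : CohomologyDatum H IsArc G) (y : ∀ v, Pt v) : Prop :=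
  ∀ v, v ∉ IsArc → y v ∈ 𝔠.canonicalFibre v

/-- The chosen `y₀` is a standard arithmeticoid (by its defining constraint). [claim: Joshi2023ATS2half, status: disputed] -/
theorem CohomologyDatum.std_isStandard (𝔠 : CohomologyDatum H IsArc G) : 𝔠.IsStandard 𝔠.std :=
  𝔠.std_mem

end GaloisCohomology

/-! ## 3. Prop. 7.2.2 and (7.3.1): the multiplicative description (Kummer theory, Bloch–Kato) — typed as claims -/

section Multiplicative

variable {V : Type u} {Pt : V → Type u} (IsArc : Set V) (p : V → ℕ)
variable (Lv : V → Type u) [∀ v, NormedField (Lv v)]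
variable (H1 : (v : V) → Pt v → Type u) [∀ v y, CommGroup (H1 v y)]
variable (H1Q : (v : V) → Pt v → Type u) [∀ v y, CommGroup (H1Q v y)]

/-- `lim_n K^×/K^{×p^n}`, the `p`-adic completion of the multiplicative group of a field, as Mathlib's adic completion of the
`ℤ`-module `Additive K^×` at the ideal `(p)` (the object on the right of Prop. 7.2.2 (2)). [folklore] -/
abbrev mulAdicCompletion (q : ℕ) (M : Type u) [CommGroup M] : Type u :=
  AdicCompletion (Ideal.span {(q : ℤ)}) (Additive M)

/-- The units of norm one `𝒪^×_K = {u ∈ K^× : ‖u‖ = 1}` of a normed field (the object `𝒪^*_{L_v}` of (7.3.1)). [folklore] -/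
def unitsNormOne (F : Type u) [NormedField F] : Subgroup Fˣ where
  carrier := {u | ‖(u : F)‖ = 1}
  mul_mem' {a b} ha hb := by
    simp only [mem_setOf_eq, Units.val_mul, norm_mul] at *
    rw [ha, hb, mul_one]
  one_mem' := by simp
  inv_mem' {a} ha := by
    simp only [mem_setOf_eq, Units.val_inv_eq_inv_val, norm_inv] at *
    rw [ha, inv_one]

/-- Membership in `𝒪^×_K`. [folklore] -/
theorem mem_unitsNormOne_iff {F : Type u} [NormedField F] (a : Fˣ) : a ∈ unitsNormOne F ↔ ‖(a : F)‖ = 1 :=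
  Iff.rfl

/-- **Prop. 7.2.2 (1)** (p.46 l.52–58): «Let L be a number field as above. Then one has the following multiplicative description
of H^i(G_{L_v}, ℤ_{p_v}(1)) at all primes v ∈ V_L. (1) For v ∈ V^arc_L, one has L_v ≃ ℂ and H^1(G_{L_v}, ℤ_{p_v}(1)) =
Ext^1_{MHS}(ℤ(0), ℤ(1)) ≃ L^*_v ≃ ℂ^*» («Proof. … one uses [Deligne, 1997] and the assumption that L has no real embeddings»,
p.47 l.20–22). Typed for the degree-one carrier `H1 v y_v`. HYPOTHESIS (claim). [claim: Joshi2023ATS2half, status: disputed] -/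
@[claim "Joshi2023ATS2half" "disputed"]
def ArcMultiplicative : Prop :=
  ∀ v ∈ IsArc, ∀ y : Pt v, Nonempty (Lv v ≃+* ℂ) ∧ Nonempty (H1 v y ≃* (Lv v)ˣ)

/-- **Prop. 7.2.2 (2), integral** (p.47 l.1–8): «For v ∈ V^non_L one has (by Kummer theory) an isomorphism of
ℤ_{p_v}-modules H^1(G_{L_v,K_v}, ℤ_{p_v}(1)) ≃ lim_n (L^*_v / L^{*p^n_v}_v)» («see [Perrin-Riou, 1994] or [Nekovář, 1993]»,
p.47 l.22), typed TOGETHER WITH the Kummer map `kum v y_v : L_v^× → H¹` it comes from («Take a compatible system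
{(q_{v_j})^{1/p^n}}_{n≥0} of p^n-th roots … This provides a Galois cohomology class», p.49 l.26–40): there is a group isomorphism
onto `lim_n L_v^×/L_v^{×p_v^n}` under which `kum` becomes the canonical map. HYPOTHESIS (claim). [claim: Joshi2023ATS2half,
status: disputed] -/
@[claim "Joshi2023ATS2half" "disputed"]
def NonarcKummer (kum : ∀ v (y : Pt v), (Lv v)ˣ →* H1 v y) : Prop :=
  ∀ v, v ∉ IsArc → ∀ y : Pt v, ∃ e : Additive (H1 v y) ≃+ mulAdicCompletion (p v) (Lv v)ˣ,
    ∀ x : (Lv v)ˣ, e (Additive.ofMul (kum v y x)) =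
      AdicCompletion.of (Ideal.span {(p v : ℤ)}) (Additive (Lv v)ˣ) (Additive.ofMul x)

/-- **Prop. 7.2.2 (2), rational** (p.47 l.9–19): «and H^1(G_{L_v,K_v}, ℚ_{p_v}(1)) ≃ (lim_n (L^*_v / L^{*p^n_v}_v)) ⊗_{ℤ_{p_v}}
ℚ_{p_v}». OUR RENDERING of `⊗_{ℤ_{p_v}} ℚ_{p_v}` as `ℚ ⊗_ℤ (·)` (equal for `ℤ_p`-modules). HYPOTHESIS (claim).
[claim: Joshi2023ATS2half, status: disputed] -/
@[claim "Joshi2023ATS2half" "disputed"]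
def NonarcKummerRational : Prop :=
  ∀ v, v ∉ IsArc → ∀ y : Pt v, Nonempty (Additive (H1Q v y) ≃+ ℚ ⊗[ℤ] mulAdicCompletion (p v) (Lv v)ˣ)

/-- **(7.3.1)** (p.48 l.5–20): «For any v ∈ V^non_L one has an isomorphism (see [Bloch and Kato, 1990], [Perrin-Riou, 1994] or
[Nekovář, 1993]) H^1_f(G_{L_v}, ℚ_{p_v}(1)) ≃ (lim_n (𝒪^*_{L_v} / 𝒪^{*p^n_v}_{L_v})) ⊗_{ℤ_{p_v}} ℚ_{p_v}», for the local rational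
Fontaine subspace `H1Qf v y_v ≤ H1Q v y_v`. OUR nearest object (not bound): [J-III] §9.1–9.2 identifies this with Mochizuki's
log-shell — `Literature.AnabelianGeometry.AbsoluteAnabelian.logShell` (E-t19, dictionary row D-08). HYPOTHESIS (claim).
[claim: Joshi2023ATS2half, status: disputed] -/
@[claim "Joshi2023ATS2half" "disputed"]
def BlochKatoUnits (H1Qf : ∀ v (y : Pt v), Subgroup (H1Q v y)) : Prop :=
  ∀ v, v ∉ IsArc → ∀ y : Pt v,
    Nonempty (Additive (H1Qf v y) ≃+ ℚ ⊗[ℤ] mulAdicCompletion (p v) (unitsNormOne (Lv v)))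

end Multiplicative

end Summit.ABC.IUTFork.Joshi.ATS2half

end
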